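import Summits.ValiantsHypothesis.ValiantsHypothesis.Theorems.BarrierLeverChowHitsThinRowPartitionMinorsRDownClosed
import Summits.ValiantsHypothesis.ValiantsHypothesis.Theorems.BarrierLeverChowThinRowsMonomialBasis

/-!
# Route BarrierLever — item `ChowHitsThinRowPartitionMinorsR` (stmt-ValiantsHypothesis-21850, budget
# `h·h`): the standard monomial basis contains every AFFINELY FREE singleton — affine defect `0` on
# the used coordinates ⇒ every thin layout is hit

Helper file (`--supports stmt-ValiantsHypothesis-21850`; cell valiant-natproofs, rung V4, 𝒟-side;
seat val-np-p5 gen 28).  Closes NO item; definition-free; imports this seat's `…RDownClosed` and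
val-np-p7 g4's `…ChowThinRowsMonomialBasis` (standard sets along the key `|S|·2^h + Σ 2^c`).

* `key_lt_key_singleton` — the sets of key smaller than that of `{c}` are `∅` and the `{c'}`, `c' < c`.
* `exists_downClosed_monomialBasis_singletons` — val-np-p7's down-closed monomial basis (the standard
  sets of the columns) CONTAINS the singleton `{c}` of every coordinate `c` whose column-indicator
  `j ↦ [c ∈ w j]` is not a linear combination of the all-ones vector and the indicators of the
  coordinates `c' < c` — in particular of every coordinate when the affine functions `1, z_c` are
  linearly independent on the column points.
* `chowHitsHH_of_freeCoordinates` — **if every coordinate used by the columns is affinely free in this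
  sense (affine defect `0` on the used coordinates), EVERY thin layout on these columns is hit by
  `h·h` affine forms, at every height** (`chowHitsHH_of_usedSingletonBasis`).  The negation — some used
  coordinate is an affine combination of `1` and the earlier coordinates on the column points — is the
  genuine «positive affine defect» of the residual of item 21850.

WHAT THIS IS NOT: item 21850 is NOT proved; nothing on items 21882 / 19717, on crux
stmt-ValiantsHypothesis-14610, or on `VP` versus `VNP`.
-/

set_option linter.dupNamespace false

namespace Summit.ValiantsHypothesis.ValiantsHypothesis.Theorems.BarrierLever.ChowThinHH

open Finset
open Summit.ValiantsHypothesis.ValiantsHypothesis.Theorems.BarrierLever.ChowThinAll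
  (card_std std_linearIndependent nonStd_mono enc_lt card_le_of_key_lt key_injective)

variable {h r : ℕ}

/-- The sets of key `|T|·2^h + Σ_{c∈T} 2^c` smaller than the key of `{c}` are `∅` and the singletons
`{c'}` with `c' < c`. -/
theorem key_lt_key_singleton (c : Fin h) (T : Finset (Fin h))
    (hT : T.card * 2 ^ h + ∑ c' ∈ T, 2 ^ (c' : ℕ) <
      ({c} : Finset (Fin h)).card * 2 ^ h + ∑ c' ∈ ({c} : Finset (Fin h)), 2 ^ (c' : ℕ)) :
    T = ∅ ∨ ∃ c' : Fin h, c' < c ∧ T = {c'} := by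
  classical
  rw [Finset.card_singleton, Finset.sum_singleton, one_mul] at hT
  have hc : 2 ^ (c : ℕ) < 2 ^ h := Nat.pow_lt_pow_right (by norm_num) c.2
  have hcard : T.card ≤ 1 := by
    by_contra hlt
    have h2 : 2 * 2 ^ h ≤ T.card * 2 ^ h := Nat.mul_le_mul_right _ (by omega)
    have := Finset.sum_nonneg (f := fun c' : Fin h => 2 ^ (c' : ℕ)) (s := T) (fun _ _ => Nat.zero_le _)
    omega
  rcases Nat.lt_or_ge T.card 1 with h0 | h1
  · exact Or.inl (Finset.card_eq_zero.mp (by omega))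
  · obtain ⟨c', rfl⟩ := Finset.card_eq_one.mp (le_antisymm hcard h1)
    refine Or.inr ⟨c', ?_, rfl⟩
    rw [Finset.card_singleton, Finset.sum_singleton, one_mul] at hT
    have hlt : 2 ^ (c' : ℕ) < 2 ^ (c : ℕ) := by omega
    exact Fin.lt_def.mpr ((Nat.pow_lt_pow_iff_right (by norm_num)).mp hlt)

open Classical in
/-- **The standard monomial basis contains every affinely free singleton.**  For injective columns
`w` there is an injective down-closed `U` with `det [U i ⊆ w j] ≠ 0` (val-np-p7's standard sets) such
that `{c}` is among the `U i` for every coordinate `c` whose indicator `j ↦ [c ∈ w j]` is not in the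
span of the all-ones vector and the indicators of the coordinates `c' < c`. -/
theorem exists_downClosed_monomialBasis_singletons (w : Fin r → Finset (Fin h))
    (hw : Function.Injective w) :
    ∃ U : Fin r → Finset (Fin h), Function.Injective U ∧
      (∀ i (S : Finset (Fin h)), S ⊆ U i → ∃ i', U i' = S) ∧
      (Matrix.of fun i j : Fin r => if U i ⊆ w j then (1 : ℂ) else 0).det ≠ 0 ∧
      ∀ c : Fin h, (fun j : Fin r => if c ∈ w j then (1 : ℂ) else 0) ∉ Submodule.span ℂ
          (insert (fun _ : Fin r => (1 : ℂ))
            ((fun c' : Fin h => fun j : Fin r => if c' ∈ w j then (1 : ℂ) else 0) '' {c' | c' < c})) →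
        ∃ i, U i = {c} := by
  set ι := {T : Finset (Fin h) //
        (fun j : Fin r => if T ⊆ w j then (1 : ℂ) else 0) ∉ Submodule.span ℂ
          ((fun S' : Finset (Fin h) => fun j : Fin r => if S' ⊆ w j then (1 : ℂ) else 0) ''
            {T' | T'.card * 2 ^ h + ∑ c ∈ T', 2 ^ (c : ℕ) < T.card * 2 ^ h + ∑ c ∈ T, 2 ^ (c : ℕ)})}
  have hcard : Fintype.card ι = r := card_std w hw
  let e : Fin r ≃ ι := (Fintype.equivFinOfCardEq hcard).symm
  refine ⟨fun i => (e i).1, Subtype.val_injective.comp e.injective, ?_, ?_, ?_⟩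
  · intro i S hS
    have hstd : (fun j : Fin r => if S ⊆ w j then (1 : ℂ) else 0) ∉ Submodule.span ℂ
        ((fun S' : Finset (Fin h) => fun j : Fin r => if S' ⊆ w j then (1 : ℂ) else 0) ''
          {T' | T'.card * 2 ^ h + ∑ c ∈ T', 2 ^ (c : ℕ) < S.card * 2 ^ h + ∑ c ∈ S, 2 ^ (c : ℕ)}) :=
      fun hN => (e i).2 (nonStd_mono w hN hS)
    refine ⟨e.symm ⟨S, hstd⟩, ?_⟩
    simp
  · have hli : LinearIndependent ℂ (fun i : Fin r => fun j : Fin r => if (e i).1 ⊆ w j then (1 : ℂ) else 0) :=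
      (std_linearIndependent w).comp e e.injective
    have hrows : LinearIndependent ℂ
        (Matrix.of fun i j : Fin r => if (e i).1 ⊆ w j then (1 : ℂ) else 0).row := by
      have e2 : (Matrix.of fun i j : Fin r => if (e i).1 ⊆ w j then (1 : ℂ) else 0).row =
          fun i : Fin r => fun j : Fin r => if (e i).1 ⊆ w j then (1 : ℂ) else 0 := by
        funext i j
        rfl
      rw [e2]
      exact hli
    have hU := Matrix.linearIndependent_rows_iff_isUnit.mp hrows
    exact ((Matrix.isUnit_iff_isUnit_det _).mp hU).ne_zero
  · intro c hc
    -- `{c}` is standard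
    have hstd : (fun j : Fin r => if ({c} : Finset (Fin h)) ⊆ w j then (1 : ℂ) else 0) ∉ Submodule.span ℂ
        ((fun S' : Finset (Fin h) => fun j : Fin r => if S' ⊆ w j then (1 : ℂ) else 0) ''
          {T' | T'.card * 2 ^ h + ∑ c' ∈ T', 2 ^ (c' : ℕ) <
            ({c} : Finset (Fin h)).card * 2 ^ h + ∑ c' ∈ ({c} : Finset (Fin h)), 2 ^ (c' : ℕ)}) := by
      intro hmem
      apply hc
      have e1 : (fun j : Fin r => if ({c} : Finset (Fin h)) ⊆ w j then (1 : ℂ) else 0) =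
          fun j : Fin r => if c ∈ w j then (1 : ℂ) else 0 := by
        funext j
        simp only [Finset.singleton_subset_iff]
      rw [e1] at hmem
      refine Submodule.span_mono ?_ hmem
      rintro _ ⟨T', hT', rfl⟩
      rcases key_lt_key_singleton c T' hT' with rfl | ⟨c', hc', rfl⟩
      · refine Set.mem_insert_iff.mpr (Or.inl ?_)
        funext j
        simp
      · refine Set.mem_insert_of_mem _ ⟨c', hc', ?_⟩
        funext j
        simp only [Finset.singleton_subset_iff]
    refine ⟨e.symm ⟨{c}, hstd⟩, ?_⟩
    simp

/-- **Affine defect `0` on the used coordinates: every thin layout is hit by `h·h` affine forms.**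
If for every coordinate `c` used by some column the indicator `j ↦ [c ∈ w j]` is not a linear
combination of the all-ones vector and the indicators of the coordinates `c' < c` (i.e. the affine
functions `1, z_c`, `c` used, are linearly independent on the column points), then every thin layout
`(u, w)` (`u` injective of size `≤ 2`, `w` injective) is hit. -/
theorem chowHitsHH_of_freeCoordinates (h r : ℕ) (u w : Fin r → Finset (Fin h))
    (hu : Function.Injective u) (hu2 : ∀ i, (u i).card ≤ 2) (hw : Function.Injective w)
    (hfree : ∀ c ∈ Finset.univ.biUnion w,
      (fun j : Fin r => if c ∈ w j then (1 : ℂ) else 0) ∉ Submodule.span ℂ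
        (insert (fun _ : Fin r => (1 : ℂ))
          ((fun c' : Fin h => fun j : Fin r => if c' ∈ w j then (1 : ℂ) else 0) '' {c' | c' < c}))) :
    ∃ ℓ : Fin (h * h) → MvPolynomial (Fin (h + h)) ℂ, (∀ k, (ℓ k).totalDegree ≤ 1) ∧
      (Matrix.of fun i j : Fin r => MvPolynomial.coeff
        (∑ a ∈ u i, Finsupp.single (Fin.castAdd h a) 1 +
          ∑ c ∈ w j, Finsupp.single (Fin.natAdd h c) 1) (∏ k, ℓ k)).det ≠ 0 := by
  classical
  obtain ⟨U, hUinj, hUdown, hZ, hUsing⟩ := exists_downClosed_monomialBasis_singletons w hw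
  exact chowHitsHH_of_usedSingletonBasis h r u w hu hu2 U hUinj hUdown hZ
    (fun c hc => hUsing c (hfree c hc))

end Summit.ValiantsHypothesis.ValiantsHypothesis.Theorems.BarrierLever.ChowThinHH
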